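import Mathlib
import HarnessLib
import Literature.Uncategorized.OscillatoryJacobi

/-!
# M1 — oscillatory Jacobi lemma (scalar model of the connection-level lever)

`J″ = −a″ J` on `[0,1]` with `|a′| ≤ δ ≤ 1` forces `J` to stay `100 δ (|J 0| + |J′ 0|)`-close to
the free motion `J 0 + s (J′ 0 + a′ 0 J 0)`, with no hypothesis on `a″`.

Main declarations: `OscillatoryJacobi` (the statement registered as stub M1 of the `NeckGapDecay`
skeleton, verbatim) and `stub_oscillatoryJacobi : Literature.Uncategorized.OscillatoryJacobi`.

Proof: `K := J′ + a′ J` satisfies `K′ = a′ J′` (the tidal term `a″ J` is absorbed into an exact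
derivative), so the pair `f := (J − (J 0 + s K 0), K − K 0)` has `f 0 = 0` and
`‖f′‖ ≤ 2 ‖f‖ + δ (|J 0| + 2 |K 0|)` on `[0,1]` (sup norm on `ℝ × ℝ`); Grönwall
(`norm_le_gronwallBound_of_norm_deriv_right_le`) gives `‖f s‖ ≤ (ε/2) (e² − 1) ≤ 4 ε`, and
`|K 0| ≤ |J′ 0| + |J 0|` finishes with constant `12 ≤ 100`.
-/

open Set

namespace Summit.FinalStateConjecture.FinalStateConjecture.Theorems.NeckGapDecay.ConnectionLevelCones.OscillatoryJacobiStub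
set_option linter.dupNamespace false

/-- Numerical bound `exp 2 ≤ 9` (from `exp 1 < 3`). [folklore] -/
private lemma exp_two_le_nine : Real.exp 2 ≤ 9 := by
  have h1 := Real.exp_one_lt_three
  have h2 : Real.exp 2 = Real.exp 1 * Real.exp 1 := by rw [← Real.exp_add]; norm_num
  rw [h2]
  nlinarith [Real.exp_pos (1 : ℝ)]

/-- The pointwise differential inequality behind the Grönwall step, as pure algebra of absolute
values: with `u := y − (J0 + x K0)`, `v := q + p y − K0`, `|p| ≤ δ ≤ 1`, `0 ≤ x ≤ 1`, both
`|q − K0|` and `|p q|` are at most `2 max |u| |v| + δ (|J0| + 2 |K0|)`. [folklore] -/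
private lemma step_bound {δ x p q y J0 K0 : ℝ} (hδ0 : 0 ≤ δ) (hδ1 : δ ≤ 1) (hx0 : 0 ≤ x)
    (hx1 : x ≤ 1) (hp : |p| ≤ δ) :
    max |q - K0| |p * q| ≤
      2 * max |y - (J0 + x * K0)| |q + p * y - K0| + δ * (|J0| + 2 * |K0|) := by
  set u := y - (J0 + x * K0) with hu
  set v := q + p * y - K0 with hv
  have hu0 : |u| ≤ max |u| |v| := le_max_left _ _
  have hv0 : |v| ≤ max |u| |v| := le_max_right _ _
  have hy : |y| ≤ |u| + |J0| + |K0| := by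
    have : y = u + J0 + x * K0 := by rw [hu]; ring
    rw [this]
    calc |u + J0 + x * K0| ≤ |u| + |J0| + |x * K0| := abs_add_three _ _ _
      _ ≤ |u| + |J0| + |K0| := by
        rw [abs_mul, abs_of_nonneg hx0]
        nlinarith [abs_nonneg K0]
  have hpy : |p * y| ≤ δ * |y| := by
    rw [abs_mul]; exact mul_le_mul_of_nonneg_right hp (abs_nonneg _)
  have hδu : δ * |u| ≤ |u| := mul_le_of_le_one_left (abs_nonneg _) hδ1
  have hδy : δ * |y| ≤ δ * (|u| + |J0| + |K0|) := mul_le_mul_of_nonneg_left hy hδ0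
  have hB : |q - K0| ≤ |v| + |u| + δ * |J0| + δ * |K0| := by
    have : q - K0 = v - p * y := by rw [hv]; ring
    rw [this]
    calc |v - p * y| ≤ |v| + |p * y| := abs_sub _ _
      _ ≤ _ := by linarith
  have hK0 : 0 ≤ δ * |K0| := mul_nonneg hδ0 (abs_nonneg _)
  refine max_le (by linarith) ?_
  have hB0 : 0 ≤ |v| + |u| + δ * |J0| + δ * |K0| := by positivity
  have hpq : |p * q| ≤ δ * |q| := by
    rw [abs_mul]; exact mul_le_mul_of_nonneg_right hp (abs_nonneg _)
  have hq : |q| ≤ |q - K0| + |K0| := by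
    calc |q| = |q - K0 + K0| := by rw [sub_add_cancel]
      _ ≤ |q - K0| + |K0| := abs_add_le _ _
  have hδq : δ * |q| ≤ δ * ((|v| + |u| + δ * |J0| + δ * |K0|) + |K0|) :=
    mul_le_mul_of_nonneg_left (hq.trans (by linarith)) hδ0
  have hδB : δ * (|v| + |u| + δ * |J0| + δ * |K0|) ≤ |v| + |u| + δ * |J0| + δ * |K0| :=
    mul_le_of_le_one_left hB0 hδ1
  linarith [mul_add δ (|v| + |u| + δ * |J0| + δ * |K0|) |K0|]

/-- Registered stub M1 (model): the oscillatory Jacobi lemma, by Grönwall on `(J − free, K − K 0)`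
with `K := J′ + a′ J`. [folklore] -/
theorem stub_oscillatoryJacobi : Literature.Uncategorized.OscillatoryJacobi := by
  intro a J δ hδ ha hJ hda hODE s hs
  obtain ⟨hδ0, hδ1⟩ := hδ
  obtain ⟨K0, hK0⟩ : ∃ K0, K0 = deriv J 0 + deriv a 0 * J 0 := ⟨_, rfl⟩
  rw [← hK0]
  -- derivative facts
  have hJd : ∀ x, HasDerivAt J (deriv J x) x := fun x ↦
    (hJ.differentiable (by norm_num) x).hasDerivAt
  have hJdd : ∀ x, HasDerivAt (deriv J) (iteratedDeriv 2 J x) x := fun x ↦ by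
    rw [iteratedDeriv_succ, iteratedDeriv_one]
    exact (hJ.differentiable_deriv_two x).hasDerivAt
  have hadd : ∀ x, HasDerivAt (deriv a) (iteratedDeriv 2 a x) x := fun x ↦ by
    rw [iteratedDeriv_succ, iteratedDeriv_one]
    exact (ha.differentiable_deriv_two x).hasDerivAt
  -- the Grönwall pair and its derivative on `[0,1]`
  set f : ℝ → ℝ × ℝ := fun x ↦ (J x - (J 0 + x * K0), deriv J x + deriv a x * J x - K0) with hf_def
  set f' : ℝ → ℝ × ℝ := fun x ↦ (deriv J x - K0, deriv a x * deriv J x) with hf'_def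
  have hf : ∀ x ∈ Icc (0 : ℝ) 1, HasDerivAt f (f' x) x := by
    intro x hx
    refine HasDerivAt.prodMk ?_ ?_
    · exact (hJd x).sub (((hasDerivAt_mul_const K0).const_add (J 0)))
    · have h1 := ((hJdd x).fun_add ((hadd x).fun_mul (hJd x))).sub_const K0
      convert h1 using 1
      rw [hODE x hx]
      ring
  have hcont : ContinuousOn f (Icc 0 1) := fun x hx ↦ (hf x hx).continuousAt.continuousWithinAt
  have hf0 : ‖f 0‖ ≤ 0 := by
    simp [hf_def, hK0]
  set ε : ℝ := δ * (|J 0| + 2 * |K0|) with hε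
  have hbound : ∀ x ∈ Ico (0 : ℝ) 1, ‖f' x‖ ≤ 2 * ‖f x‖ + ε := by
    intro x hx
    simp only [hf_def, hf'_def, Prod.norm_mk, Real.norm_eq_abs]
    exact step_bound hδ0 hδ1 hx.1 hx.2.le (hda x (Ico_subset_Icc_self hx))
  have hgr := norm_le_gronwallBound_of_norm_deriv_right_le (f := f) (f' := f') hcont
    (fun x hx ↦ (hf x (Ico_subset_Icc_self hx)).hasDerivWithinAt) hf0 hbound s hs
  simp only [gronwallBound_of_K_ne_0 (two_ne_zero (α := ℝ)), sub_zero, zero_mul, zero_add] at hgr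
  -- numerical finish
  have h1 : |J s - (J 0 + s * K0)| ≤ ‖f s‖ := norm_fst_le (f s)
  have hexp : Real.exp (2 * s) ≤ 9 :=
    (Real.exp_le_exp.2 (by linarith [hs.2])).trans exp_two_le_nine
  have hε0 : 0 ≤ ε := by positivity
  have hεexp : ε * Real.exp (2 * s) ≤ ε * 9 := mul_le_mul_of_nonneg_left hexp hε0
  have hK0abs : |K0| ≤ |deriv J 0| + |J 0| := by
    rw [hK0]
    calc |deriv J 0 + deriv a 0 * J 0| ≤ |deriv J 0| + |deriv a 0 * J 0| := abs_add_le _ _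
      _ ≤ |deriv J 0| + |J 0| := by
        rw [abs_mul]
        nlinarith [hda 0 ⟨le_rfl, zero_le_one⟩, abs_nonneg (J 0), abs_nonneg (deriv a 0)]
  have hδK0 : δ * |K0| ≤ δ * (|deriv J 0| + |J 0|) := mul_le_mul_of_nonneg_left hK0abs hδ0
  have hfs : ‖f s‖ ≤ 4 * ε := by
    have : ε / 2 * (Real.exp (2 * s) - 1) ≤ 4 * ε := by nlinarith
    exact hgr.trans this
  have hJ0 : 0 ≤ δ * |J 0| := mul_nonneg hδ0 (abs_nonneg _)
  have hJ1 : 0 ≤ δ * |deriv J 0| := mul_nonneg hδ0 (abs_nonneg _)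
  calc |J s - (J 0 + s * K0)| ≤ 4 * ε := h1.trans hfs
    _ = 4 * (δ * |J 0|) + 8 * (δ * |K0|) := by rw [hε]; ring
    _ ≤ 4 * (δ * |J 0|) + 8 * (δ * (|deriv J 0| + |J 0|)) := by linarith
    _ ≤ 100 * δ * (|J 0| + |deriv J 0|) := by nlinarith

end Summit.FinalStateConjecture.FinalStateConjecture.Theorems.NeckGapDecay.ConnectionLevelCones.OscillatoryJacobiStub
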